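import Summits.QuantumFields.BalabanUV.T4Continuum.Support.RegionStarBoundaryCharges
import Summits.QuantumFields.BalabanUV.T4Continuum.Support.RegionGaffneyIdentity

/-!
# T⁴ programme, spine node NE2 (U1a), sub-row Δ1 «NE2⁰-Dirichlet» — THE INTERIOR GAFFNEY INEQUALITY OF A REGION WITHOUT RE-ENTRANT
# CONTACT: `Σ_μ ‖igrad_μ A‖² ≤ ‖curl_Ω A‖² + ‖∂_Ω*A‖²` with CONSTANT 1 (every product region `IsCoordBox`, every level `n ≥ 2`)

NE2 formalisation swarm `b2b-balaban-t4-ne2-formalise-*`, LEAF PROVER 07 (gen 7), supplier item «Δ1-VEC-INTERIOR-W2-BOX», file 2 of 3,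
on file 1 `Support/RegionStarBoundaryCharges` (H1 = `AtMostOneNeighbour`, the boundary charges `cntR`, the decomposition
`sum_nsq_fdiff_ext_eq`) and gen 6's lattice Gaffney IDENTITY of a region `RegionGaffneyIdentity.gaffney_region` (p228054:
`‖curlR A‖² + ‖gradRᴴA‖² + extFlux A = Σ_ν ‖∇_ν ιA‖²`).  THIS FILE:

 * §3 under H1 the EXTERIOR FLUX is dominated by the boundary charges: `divS_ext_sq_le` (each exterior divergence is fed by at most ONE
   star bond, `norm_sum_sq_le_of_pairwise`), `sum_tail_eq` / `sum_head_eq` (the charges live on the star bonds), `bdry_le_cntR` (under H1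
   the outward own-direction translate of a boundary star bond is not a star bond), **`extFlux_le`**: `extFlux A ≤ n²·Σ_b cntR(b)·‖A b‖²`;
 * §4 the ENDs **`interior_gaffney (hH : AtMostOneNeighbour n M S)`** and **`interior_gaffney_box (hn : 2 ≤ n) (hS : IsCoordBox M S)`**:
   `Σ_μ nsq (igrad M S n μ A) ≤ nsq (curlR n M S A) + nsq ((gradR n M S)ᴴ A)` for EVERY `A` on the star bonds — the lattice «electric
   Gaffney inequality» with tangential boundary condition (zero extension) in the INTERIOR norm: constant `1`, no dependence on `n`, `d`,
   the torus or the size of the region.  (Numerically, g5 `tables.final.md`, interior-ratio minimisers at k = 4: one block 15.4 ≤ 17.6,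
   box 2×2 17.7 ≤ 18.7, slab 18.5 ≤ 19.2; torus∖block (four re-entrant corners, k = 5) 30.3 > 8.9 — the inequality holds exactly where
   H1 holds.)

HONEST FRAMING (T4-DAG p. 1).  Lattice calculus at MODEL level (`U = 1`, ONE region, finite torus); statements OURS ([folklore]); nothing
printed is a hypothesis; re-entrant unions are NOT covered; W1 (`SliceCoercive`, G-ne2leaf07g5-1) OPEN; NE2 (U1a) NOT proved; spine 0/9
unchanged; NOT [B9] (3.16)/(3.23)–(3.27) as printed; NOT infinite volume, NOT a mass gap, NOT the Clay problem, NOT summit progress.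
HONEST DEPENDENCY: continuum YM on T⁴ ⇐ BetaPertH ∧ nine spine estimates (0/9 proved); BetaPertH ⇐ (D1) ∧ (D4) ∧ CAP+tail; G-an2-4
gates asym, D1 and NE2/3/4.  No `sorry`.
-/

noncomputable section

open scoped BigOperators ComplexConjugate Matrix Matrix.Norms.L2Operator
open Finset

namespace Summit.QuantumFields.BalabanUV.T4Continuum.RegionInteriorGaffney

open Literature.MathematicalPhysics.QuantumFieldTheory.Balaban1983to89.B5Prop11Plancherel (Tor fine fdiff unitVec)
open Literature.MathematicalPhysics.QuantumFieldTheory.Balaban1983to89.B5Prop11Lower (nsq nsq_nonneg)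
open Literature.MathematicalPhysics.QuantumFieldTheory.Balaban1983to89.B5Action121 (GradOp divS divS_apply
  GradOp_conjTranspose_mulVec_eq)
open Summit.QuantumFields.BalabanUV.T4Continuum
open Summit.QuantumFields.BalabanUV.T4Continuum.SubtypeCompression (ext ext_apply_of ext_apply_of_not)
open Summit.QuantumFields.BalabanUV.T4Continuum.RegionGaugeFixedVector (starReg curlR gradR)
open Summit.QuantumFields.BalabanUV.T4Continuum.DirichletStarRenormTower (igrad)
open Summit.QuantumFields.BalabanUV.T4Continuum.RegionGaffneyIdentity (extFlux gaffney_region)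
open Summit.QuantumFields.BalabanUV.T4Continuum.RegionStarBoundaryCharges
open Summit.QuantumFields.BalabanUV.Beta.GAN24.DirichletBoxTrace (blockReg)
open Summit.QuantumFields.BalabanUV.Beta.GAN24.DirichletBoxTwoLevel (IsCoordBox)

variable {d : ℕ}

section Region

variable (n : ℕ) [NeZero n] (M : Fin d → ℕ) [hM : ∀ μ, NeZero (M μ)] (S : Tor M → Prop) [DecidablePred S]

/-! ## §3 Under H1 the exterior flux is dominated by the boundary charges -/

/-- the exterior divergence at one site outside `Ω`, under H1: at most one feeding bond, so
`‖(∂ᴴιA)(x)‖² ≤ n²·Σ_μ (‖ιA(x − e_μ, μ)‖² + ‖ιA(x, μ)‖²)`. [folklore] -/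
theorem divS_ext_sq_le (hH : AtMostOneNeighbour n M S) (A : {b // starReg n M S b} → ℂ) {x : Tor (fine n M)}
    (hx : ¬ blockReg n M S x) :
    ‖divS (fine n M) (n : ℂ) (ext (starReg n M S) A) x‖ ^ 2
      ≤ (n : ℝ) ^ 2 * ∑ μ, (‖ext (starReg n M S) A (x - unitVec (fine n M) μ, μ)‖ ^ 2 + ‖ext (starReg n M S) A (x, μ)‖ ^ 2) := by
  -- the `2d` contributions, indexed by (direction, sign)
  set w : Fin d × Bool → ℂ := fun i =>
    if i.2 then -((n : ℂ) * ext (starReg n M S) A (x, i.1)) else (n : ℂ) * ext (starReg n M S) A (x - unitVec (fine n M) i.1, i.1)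
    with hw
  have hsum : divS (fine n M) (n : ℂ) (ext (starReg n M S) A) x = ∑ i, w i := by
    rw [divS_apply, Fintype.sum_prod_type]
    refine sum_congr rfl fun μ _ => ?_
    rw [Fintype.sum_bool]
    simp only [hw, if_true, Bool.false_eq_true, if_false, Complex.conj_natCast]
    ring
  -- a non-zero contribution comes from a neighbour inside `Ω`
  have hnz : ∀ i, w i ≠ 0 → blockReg n M S (nbr n M x i) := by
    rintro ⟨μ, b⟩ hi
    cases b
    · simp only [hw, Bool.false_eq_true, if_false] at hi
      have h' : ext (starReg n M S) A (x - unitVec (fine n M) μ, μ) ≠ 0 := fun h0 => hi (by rw [h0, mul_zero])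
      have hs : starReg n M S (x - unitVec (fine n M) μ, μ) := by
        by_contra hs; exact h' (ext_apply_of_not _ _ hs)
      rcases hs with h1 | h2
      · simpa [nbr] using h1
      · simp only [sub_add_cancel] at h2; exact absurd h2 hx
    · simp only [hw, if_true] at hi
      have h' : ext (starReg n M S) A (x, μ) ≠ 0 := fun h0 => hi (by rw [h0, mul_zero, neg_zero])
      have hs : starReg n M S (x, μ) := by
        by_contra hs; exact h' (ext_apply_of_not _ _ hs)
      rcases hs with h1 | h2
      · exact absurd h1 hx
      · simpa [nbr] using h2
  have hpair : ∀ i j, i ≠ j → w i = 0 ∨ w j = 0 := by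
    intro i j hij
    by_contra hc
    rw [not_or] at hc
    exact hij (hH x hx i j (hnz i hc.1) (hnz j hc.2))
  rw [hsum]
  refine (norm_sum_sq_le_of_pairwise w hpair).trans (le_of_eq ?_)
  rw [Fintype.sum_prod_type, mul_sum]
  refine sum_congr rfl fun μ _ => ?_
  rw [Fintype.sum_bool]
  simp only [hw, if_true, Bool.false_eq_true, if_false, norm_neg, norm_mul, Complex.norm_natCast, mul_pow]
  ring

/-- the charges `Σ_{x ∉ Ω} Σ_μ ‖ιA(x, μ)‖²` (tail outside) live on the star bonds. [folklore] -/
theorem sum_tail_eq (A : {b // starReg n M S b} → ℂ) :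
    ∑ x : {x // ¬ blockReg n M S x}, ∑ μ, ‖ext (starReg n M S) A (x.1, μ)‖ ^ 2
      = ∑ y : {b // starReg n M S b}, (if blockReg n M S y.1.1 then (0 : ℝ) else ‖A y‖ ^ 2) := by
  set F : Tor (fine n M) → ℝ := fun x => if blockReg n M S x then 0 else ∑ μ, ‖ext (starReg n M S) A (x, μ)‖ ^ 2 with hF
  have h1 : ∑ x : {x // ¬ blockReg n M S x}, ∑ μ, ‖ext (starReg n M S) A (x.1, μ)‖ ^ 2 = ∑ x, F x := by
    rw [← Fintype.sum_subtype_add_sum_subtype (blockReg n M S) F]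
    have h0 : ∑ x : {x // blockReg n M S x}, F x = 0 := sum_eq_zero fun x _ => by simp only [hF, x.2, if_true]
    rw [h0, zero_add]
    exact sum_congr rfl fun x _ => by simp only [hF, x.2, if_false]
  set G : Tor (fine n M) × Fin d → ℝ := fun c => if blockReg n M S c.1 then 0 else ‖ext (starReg n M S) A c‖ ^ 2 with hG
  have h2 : ∑ x, F x = ∑ c, G c := by
    rw [Fintype.sum_prod_type]
    refine sum_congr rfl fun x _ => ?_
    simp only [hF, hG]
    split_ifs
    · simp
    · rfl
  have h3 : ∑ c, G c = ∑ y : {b // starReg n M S b}, (if blockReg n M S y.1.1 then (0 : ℝ) else ‖A y‖ ^ 2) := by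
    rw [← Fintype.sum_subtype_add_sum_subtype (starReg n M S) G]
    have h0 : ∑ z : {b // ¬ starReg n M S b}, G z = 0 := sum_eq_zero fun z _ => by
      simp only [hG]
      split_ifs
      · rfl
      · rw [ext_apply_of_not _ _ z.2, norm_zero, zero_pow two_ne_zero]
    rw [h0, add_zero]
    refine sum_congr rfl fun y _ => ?_
    simp only [hG]
    split_ifs
    · rfl
    · rw [ext_apply_of]
  rw [h1, h2, h3]

/-- the charges `Σ_{x ∉ Ω} Σ_μ ‖ιA(x − e_μ, μ)‖²` (head outside) live on the star bonds. [folklore] -/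
theorem sum_head_eq (A : {b // starReg n M S b} → ℂ) :
    ∑ x : {x // ¬ blockReg n M S x}, ∑ μ, ‖ext (starReg n M S) A (x.1 - unitVec (fine n M) μ, μ)‖ ^ 2
      = ∑ y : {b // starReg n M S b}, (if blockReg n M S (y.1.1 + unitVec (fine n M) y.1.2) then (0 : ℝ) else ‖A y‖ ^ 2) := by
  set F : Tor (fine n M) → ℝ := fun x =>
    if blockReg n M S x then 0 else ∑ μ, ‖ext (starReg n M S) A (x - unitVec (fine n M) μ, μ)‖ ^ 2 with hF
  have h1 : ∑ x : {x // ¬ blockReg n M S x}, ∑ μ, ‖ext (starReg n M S) A (x.1 - unitVec (fine n M) μ, μ)‖ ^ 2 = ∑ x, F x := by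
    rw [← Fintype.sum_subtype_add_sum_subtype (blockReg n M S) F]
    have h0 : ∑ x : {x // blockReg n M S x}, F x = 0 := sum_eq_zero fun x _ => by simp only [hF, x.2, if_true]
    rw [h0, zero_add]
    exact sum_congr rfl fun x _ => by simp only [hF, x.2, if_false]
  -- per direction, translate `x ↦ x + e_μ`
  set G : Tor (fine n M) × Fin d → ℝ := fun c =>
    if blockReg n M S (c.1 + unitVec (fine n M) c.2) then 0 else ‖ext (starReg n M S) A c‖ ^ 2 with hG
  have h2 : ∑ x, F x = ∑ c, G c := by
    have e1 : ∑ x, F x = ∑ μ : Fin d, ∑ x : Tor (fine n M),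
        (if blockReg n M S x then (0 : ℝ) else ‖ext (starReg n M S) A (x - unitVec (fine n M) μ, μ)‖ ^ 2) := by
      rw [sum_comm]
      refine sum_congr rfl fun x _ => ?_
      simp only [hF]
      split_ifs
      · simp
      · rfl
    rw [e1, Fintype.sum_prod_type_right]
    refine sum_congr rfl fun μ _ => ?_
    refine Fintype.sum_equiv (Equiv.subRight (unitVec (fine n M) μ)) _ _ fun x => ?_
    simp only [hG, Equiv.subRight_apply, sub_add_cancel]
  have h3 : ∑ c, G c
      = ∑ y : {b // starReg n M S b}, (if blockReg n M S (y.1.1 + unitVec (fine n M) y.1.2) then (0 : ℝ) else ‖A y‖ ^ 2) := by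
    rw [← Fintype.sum_subtype_add_sum_subtype (starReg n M S) G]
    have h0 : ∑ z : {b // ¬ starReg n M S b}, G z = 0 := sum_eq_zero fun z _ => by
      simp only [hG]
      split_ifs
      · rfl
      · rw [ext_apply_of_not _ _ z.2, norm_zero, zero_pow two_ne_zero]
    rw [h0, add_zero]
    refine sum_congr rfl fun y _ => ?_
    simp only [hG]
    split_ifs
    · rfl
    · rw [ext_apply_of]
  rw [h1, h2, h3]

/-- under H1 the two boundary indicators of a star bond are dominated by its boundary charge:
`[tail ∉ Ω] + [head ∉ Ω] ≤ cntR`. [folklore] -/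
theorem bdry_le_cntR (hH : AtMostOneNeighbour n M S) (y : {b // starReg n M S b}) :
    (if blockReg n M S y.1.1 then (0 : ℝ) else ‖(1 : ℂ)‖ ^ 0)
      + (if blockReg n M S (y.1.1 + unitVec (fine n M) y.1.2) then (0 : ℝ) else ‖(1 : ℂ)‖ ^ 0) ≤ cntR n M S y.1 := by
  obtain ⟨⟨x, ν⟩, hy⟩ := y
  simp only [pow_zero]
  -- the own-direction translates
  have htail : (if blockReg n M S x then (0 : ℝ) else 1)
      ≤ (if starReg n M S (x - unitVec (fine n M) ν, ν) then (0 : ℝ) else 1) := by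
    by_cases hx : blockReg n M S x
    · rw [if_pos hx]; split_ifs <;> norm_num
    · have hz : blockReg n M S (x + unitVec (fine n M) ν) := hy.resolve_left hx
      have hns : ¬ starReg n M S (x - unitVec (fine n M) ν, ν) := by
        rintro (h1 | h2)
        · have := hH x hx (ν, true) (ν, false) (by simpa [nbr] using hz) (by simpa [nbr] using h1)
          simp at this
        · simp only [sub_add_cancel] at h2; exact hx h2
      rw [if_neg hx, if_neg hns]
  have hhead : (if blockReg n M S (x + unitVec (fine n M) ν) then (0 : ℝ) else 1)
      ≤ (if starReg n M S (x + unitVec (fine n M) ν, ν) then (0 : ℝ) else 1) := by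
    by_cases hz : blockReg n M S (x + unitVec (fine n M) ν)
    · rw [if_pos hz]; split_ifs <;> norm_num
    · have hx : blockReg n M S x := hy.resolve_right hz
      have hns : ¬ starReg n M S (x + unitVec (fine n M) ν, ν) := by
        rintro (h1 | h2)
        · exact hz h1
        · have := hH (x + unitVec (fine n M) ν) hz (ν, false) (ν, true)
            (by simpa [nbr] using hx) (by simpa [nbr] using h2)
          simp at this
      rw [if_neg hz, if_neg hns]
  refine (add_le_add htail hhead).trans ?_
  rw [add_comm]
  unfold cntR
  exact single_le_sum (f := fun μ => (if starReg n M S (x + unitVec (fine n M) μ, ν) then (0 : ℝ) else 1)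
      + (if starReg n M S (x - unitVec (fine n M) μ, ν) then (0 : ℝ) else 1))
    (fun μ _ => add_nonneg (by split_ifs <;> norm_num) (by split_ifs <;> norm_num)) (mem_univ ν)

/-- **THE EXTERIOR FLUX UNDER H1**: `extFlux A ≤ n²·Σ_{b star} cntR(b)·‖A b‖²`. [folklore] -/
theorem extFlux_le (hH : AtMostOneNeighbour n M S) (A : {b // starReg n M S b} → ℂ) :
    extFlux n M S A ≤ (n : ℝ) ^ 2 * ∑ y : {b // starReg n M S b}, cntR n M S y.1 * ‖A y‖ ^ 2 := by
  unfold extFlux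
  rw [GradOp_conjTranspose_mulVec_eq]
  calc ∑ x : {x // ¬ blockReg n M S x}, ‖divS (fine n M) (n : ℂ) (ext (starReg n M S) A) x‖ ^ 2
      ≤ ∑ x : {x // ¬ blockReg n M S x}, (n : ℝ) ^ 2 *
          ∑ μ, (‖ext (starReg n M S) A (x.1 - unitVec (fine n M) μ, μ)‖ ^ 2 + ‖ext (starReg n M S) A (x.1, μ)‖ ^ 2) :=
        sum_le_sum fun x _ => divS_ext_sq_le n M S hH A x.2
    _ = (n : ℝ) ^ 2 * ∑ y : {b // starReg n M S b},
          ((if blockReg n M S (y.1.1 + unitVec (fine n M) y.1.2) then (0 : ℝ) else ‖A y‖ ^ 2)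
            + (if blockReg n M S y.1.1 then (0 : ℝ) else ‖A y‖ ^ 2)) := by
        rw [← mul_sum, sum_congr rfl fun x _ => sum_add_distrib, sum_add_distrib, sum_head_eq, sum_tail_eq, ← sum_add_distrib]
    _ ≤ (n : ℝ) ^ 2 * ∑ y : {b // starReg n M S b}, cntR n M S y.1 * ‖A y‖ ^ 2 := by
        refine mul_le_mul_of_nonneg_left (sum_le_sum fun y _ => ?_) (sq_nonneg _)
        have hb := bdry_le_cntR n M S hH y
        simp only [pow_zero] at hb
        have hA : 0 ≤ ‖A y‖ ^ 2 := sq_nonneg _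
        calc (if blockReg n M S (y.1.1 + unitVec (fine n M) y.1.2) then (0 : ℝ) else ‖A y‖ ^ 2)
              + (if blockReg n M S y.1.1 then (0 : ℝ) else ‖A y‖ ^ 2)
            = ((if blockReg n M S y.1.1 then (0 : ℝ) else 1)
                + (if blockReg n M S (y.1.1 + unitVec (fine n M) y.1.2) then (0 : ℝ) else 1)) * ‖A y‖ ^ 2 := by
              split_ifs <;> ring
          _ ≤ cntR n M S y.1 * ‖A y‖ ^ 2 := mul_le_mul_of_nonneg_right hb hA

/-! ## §4 The interior Gaffney inequality -/

/-- **THE INTERIOR GAFFNEY INEQUALITY UNDER H1**: `Σ_μ ‖igrad_μ A‖² ≤ ‖curlR A‖² + ‖gradRᴴ A‖²` for EVERY field `A` on the star bonds —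
constant `1`, no dependence on `n`, `d`, the torus or the region's size. [folklore] -/
theorem interior_gaffney (hH : AtMostOneNeighbour n M S) (A : {b // starReg n M S b} → ℂ) :
    ∑ μ, nsq (igrad M S n μ A) ≤ nsq (curlR n M S *ᵥ A) + nsq ((gradR n M S)ᴴ *ᵥ A) := by
  have h1 := gaffney_region n M S A
  rw [sum_nsq_fdiff_ext_eq] at h1
  have h2 := extFlux_le n M S hH A
  linarith

/-- **THE INTERIOR GAFFNEY INEQUALITY ON PRODUCT REGIONS** (every `IsCoordBox`, every level `n ≥ 2`). [folklore] -/
theorem interior_gaffney_box (hn : 2 ≤ n) (hS : IsCoordBox M S) (A : {b // starReg n M S b} → ℂ) :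
    ∑ μ, nsq (igrad M S n μ A) ≤ nsq (curlR n M S *ᵥ A) + nsq ((gradR n M S)ᴴ *ᵥ A) :=
  interior_gaffney n M S (atMostOneNeighbour_of_isCoordBox n M S hn hS) A

end Region

end Summit.QuantumFields.BalabanUV.T4Continuum.RegionInteriorGaffney

end
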